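import Summits.CriticalPhenomena.PercolationContinuityZ3.Theorems.PercNearOneGluingNoHeavyLowerTailSahiTwoLevelSaturation
import Mathlib.Tactic.Linarith
import Mathlib.Tactic.Ring
import HarnessLib

/-!
# The CORRELATION FACE of the two-level top law: `T⁺ = E_3(G) + E_3(H) + M + S`

Support file of the one-cut programme (crux `NoHeavyLowerTail`, stmt-CriticalPhenomena-4575; master-family line P2 = Sahi's algebraic route,
seat `prim-masterthm-p2` gen 23; memo `run/shared/lean/prim/prim-masterthm/FROM-prim-masterthm-p2-g23-CORRELATION-FACE.md`).
Pure identities and their immediate corollaries; no `sorry`, no definitions, no named facts; axioms standard.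

SETTING (`…SahiTwoLevelC3`, `…SahiTwoLevelVariational`).  For a nested pair `H_i ⊆ G_i` (`i = 0,1,2`) of triples of events of a finite cube
under `μ = prodBernoulli q`, write `g_i = μ G_i`, `h_i = μ H_i`, `δ_i = g_i − h_i` (the shell masses) and `T⁺ = topForm q G H` (the TOP two-level form,
`3β₂ − β₃` of the fibre cubic whose sections are `(G,H)`; `SahiTwoLevelPlus` = "`T⁺ ≥ 0` always" implies Kahn's Conjecture 5).  THIS FILE:

* `topForm_eq_sahiE3_add_sahiE3_add_corrGap` — the **CORRELATION FORM** of `T⁺` (a ring identity in the fourteen moments):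
  `T⁺(G,H) = E_3(G) + E_3(H) + M + S`,  `M = δ₀δ₁h₂ + δ₀δ₂h₁ + δ₁δ₂h₀ + δ₀δ₁δ₂ ≥ 0`,
  `S = Σ_i δ_i·[Cov(G_j,G_k) − Cov(H_j,H_k)]`  ({j,k} the other two slots).
  So `T⁺ < 0` forces the shell-weighted BOTTOM correlations to exceed the TOP correlations by more than `E_3(G) + E_3(H) + M`.
  (`M + S` is the coordinate piece `b₂` of `…SahiCoordinateBernstein` read at a section pair, cf. `SahiTwoLevel.coordPiece₂_add_eq_twoLevelPlus`;
  the covariance form and its use as a FACE of the nested-pair space are the point here.)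
* `sahiE3_add_sahiE3_le_topForm_of_corrGap_nonneg`, `topForm_nonneg_of_corrGap_nonneg` — the **CORRELATION FACE** `M + S ≥ 0`:
  on it `T⁺ ≥ E_3(G) + E_3(H)`, hence `T⁺ ≥ 0` from `E_3 ≥ 0` for the two one-level triples (induction hypotheses in the coordinate induction).
* `corrGap_eq_bracket_of_idle₀` — with slot `0` idle (`H₀ = G₀`) the gap `M + S` IS the bracket
  `δ₂·μ(G₀ ∩ D₁) + δ₁·μ(G₀ ∩ D₂) − μ(G₀)δ₁δ₂` of the idle face (`…SahiTwoLevelIdleFace`, `SahiTwoLevelVariational.FaceAt`): the correlation face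
  extends the idle-bracket face to pairs with no idle slot.
* `sahiE3_add_sahiE3_sub_le_topForm` — unconditionally `T⁺ ≥ E_3(G) + E_3(H) − (δ₀δ₁h₂ + δ₀δ₂h₁ + δ₁δ₂h₀ + 2δ₀δ₁δ₂)` (from `μ(H_j∩H_k) ≤ μ(G_j∩G_k)`).
* `sahiE3_nonneg_of_corrGapAt_nonneg` — good-coordinate form: a coordinate whose section pair lies in the correlation face is a good coordinate
  (`E_3(U) ≥ 0` from `E_3 ≥ 0` for the two section triples), via `sahiE3_nonneg_of_topForm_secAt_nonneg`.

CENSUS (this seat, gen 23; exact rational arithmetic + tensor-Bernstein certificates, memo §2): `M + S` is Bernstein-nonnegative in the section biases —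
hence `≥ 0` for EVERY product measure — at every coordinate of the 4-coin obstruction `U_i = (x_a ∨ x_b)(x_c ∨ x_d)` of all containment faces, at 4 of the
6 coordinates of the first type-resistant triple `U*` (incl. its triply-essential one), at every coordinate of both `K₆` 1-factorisation petal triples, and at
some coordinate of 123 of the 127 residual `S₅×S₃`-orbits of the saturated 5-cube (numerically of all 127); it fails at every coordinate of two explicit
hard 6-coin triples.  HONEST LABEL: a face and identities; `SahiTwoLevelPlus` / Kahn's Conjecture 5 remain OPEN. [this work]
-/

noncomputable section

open scoped Classical

namespace Summit.CriticalPhenomena.PercolationContinuityZ3.Theorems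

namespace SahiTwoLevelVariational

open Finset Function MeasureTheory
open Literature.Combinatorics.Sahi2008
open Literature.Probability.LatticeModels (prodBernoulli sahiE3 sahiE3_def)

variable {κ : Type} [Fintype κ]

/-! ### 1. The correlation form of `T⁺` -/

omit [Fintype κ] in
/-- **CORRELATION FORM of the top two-level form**: `T⁺(G,H) = E_3(G) + E_3(H) + M + S` with
`M = δ₀δ₁h₂ + δ₀δ₂h₁ + δ₁δ₂h₀ + δ₀δ₁δ₂` and `S = Σ_i δ_i [Cov(G_j,G_k) − Cov(H_j,H_k)]` (`δ_i = μG_i − μH_i`).  A ring identity in the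
moments (no nestedness or monotonicity needed). [this work] -/
theorem topForm_eq_sahiE3_add_sahiE3_add_corrGap (q : κ → unitInterval) (G H : Fin 3 → Set (Set κ)) :
    topForm q G H =
      sahiE3 (prodBernoulli q) (G 0) (G 1) (G 2) + sahiE3 (prodBernoulli q) (H 0) (H 1) (H 2)
      + (((prodBernoulli q).real (G 0) - (prodBernoulli q).real (H 0)) * ((prodBernoulli q).real (G 1) - (prodBernoulli q).real (H 1))
            * (prodBernoulli q).real (H 2)
        + ((prodBernoulli q).real (G 0) - (prodBernoulli q).real (H 0)) * ((prodBernoulli q).real (G 2) - (prodBernoulli q).real (H 2))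
            * (prodBernoulli q).real (H 1)
        + ((prodBernoulli q).real (G 1) - (prodBernoulli q).real (H 1)) * ((prodBernoulli q).real (G 2) - (prodBernoulli q).real (H 2))
            * (prodBernoulli q).real (H 0)
        + ((prodBernoulli q).real (G 0) - (prodBernoulli q).real (H 0)) * ((prodBernoulli q).real (G 1) - (prodBernoulli q).real (H 1))
            * ((prodBernoulli q).real (G 2) - (prodBernoulli q).real (H 2)))
      + (((prodBernoulli q).real (G 0) - (prodBernoulli q).real (H 0))
            * (((prodBernoulli q).real (G 1 ∩ G 2) - (prodBernoulli q).real (G 1) * (prodBernoulli q).real (G 2))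
              - ((prodBernoulli q).real (H 1 ∩ H 2) - (prodBernoulli q).real (H 1) * (prodBernoulli q).real (H 2)))
        + ((prodBernoulli q).real (G 1) - (prodBernoulli q).real (H 1))
            * (((prodBernoulli q).real (G 0 ∩ G 2) - (prodBernoulli q).real (G 0) * (prodBernoulli q).real (G 2))
              - ((prodBernoulli q).real (H 0 ∩ H 2) - (prodBernoulli q).real (H 0) * (prodBernoulli q).real (H 2)))
        + ((prodBernoulli q).real (G 2) - (prodBernoulli q).real (H 2))
            * (((prodBernoulli q).real (G 0 ∩ G 1) - (prodBernoulli q).real (G 0) * (prodBernoulli q).real (G 1))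
              - ((prodBernoulli q).real (H 0 ∩ H 1) - (prodBernoulli q).real (H 0) * (prodBernoulli q).real (H 1)))) := by
  rw [topForm_eq_compact, sahiE3_def, sahiE3_def]
  ring

/-! ### 2. The correlation face -/

omit [Fintype κ] in
/-- **The CORRELATION FACE**: if `M + S ≥ 0` (shell-weighted bottom correlations do not exceed the top correlations by more than `M`), then
`E_3(G) + E_3(H) ≤ T⁺(G,H)`. [this work] -/
theorem sahiE3_add_sahiE3_le_topForm_of_corrGap_nonneg (q : κ → unitInterval) (G H : Fin 3 → Set (Set κ))
    (hCF : 0 ≤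
      (((prodBernoulli q).real (G 0) - (prodBernoulli q).real (H 0)) * ((prodBernoulli q).real (G 1) - (prodBernoulli q).real (H 1))
            * (prodBernoulli q).real (H 2)
        + ((prodBernoulli q).real (G 0) - (prodBernoulli q).real (H 0)) * ((prodBernoulli q).real (G 2) - (prodBernoulli q).real (H 2))
            * (prodBernoulli q).real (H 1)
        + ((prodBernoulli q).real (G 1) - (prodBernoulli q).real (H 1)) * ((prodBernoulli q).real (G 2) - (prodBernoulli q).real (H 2))
            * (prodBernoulli q).real (H 0)
        + ((prodBernoulli q).real (G 0) - (prodBernoulli q).real (H 0)) * ((prodBernoulli q).real (G 1) - (prodBernoulli q).real (H 1))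
            * ((prodBernoulli q).real (G 2) - (prodBernoulli q).real (H 2)))
      + (((prodBernoulli q).real (G 0) - (prodBernoulli q).real (H 0))
            * (((prodBernoulli q).real (G 1 ∩ G 2) - (prodBernoulli q).real (G 1) * (prodBernoulli q).real (G 2))
              - ((prodBernoulli q).real (H 1 ∩ H 2) - (prodBernoulli q).real (H 1) * (prodBernoulli q).real (H 2)))
        + ((prodBernoulli q).real (G 1) - (prodBernoulli q).real (H 1))
            * (((prodBernoulli q).real (G 0 ∩ G 2) - (prodBernoulli q).real (G 0) * (prodBernoulli q).real (G 2))
              - ((prodBernoulli q).real (H 0 ∩ H 2) - (prodBernoulli q).real (H 0) * (prodBernoulli q).real (H 2)))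
        + ((prodBernoulli q).real (G 2) - (prodBernoulli q).real (H 2))
            * (((prodBernoulli q).real (G 0 ∩ G 1) - (prodBernoulli q).real (G 0) * (prodBernoulli q).real (G 1))
              - ((prodBernoulli q).real (H 0 ∩ H 1) - (prodBernoulli q).real (H 0) * (prodBernoulli q).real (H 1))))) :
    sahiE3 (prodBernoulli q) (G 0) (G 1) (G 2) + sahiE3 (prodBernoulli q) (H 0) (H 1) (H 2) ≤ topForm q G H := by
  rw [topForm_eq_sahiE3_add_sahiE3_add_corrGap]
  linarith

omit [Fintype κ] in
/-- **On the correlation face the top law follows from `E_3 ≥ 0` for the two one-level triples** (`G` and `H`). [this work] -/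
theorem topForm_nonneg_of_corrGap_nonneg (q : κ → unitInterval) (G H : Fin 3 → Set (Set κ))
    (hG : 0 ≤ sahiE3 (prodBernoulli q) (G 0) (G 1) (G 2)) (hH : 0 ≤ sahiE3 (prodBernoulli q) (H 0) (H 1) (H 2))
    (hCF : 0 ≤
      (((prodBernoulli q).real (G 0) - (prodBernoulli q).real (H 0)) * ((prodBernoulli q).real (G 1) - (prodBernoulli q).real (H 1))
            * (prodBernoulli q).real (H 2)
        + ((prodBernoulli q).real (G 0) - (prodBernoulli q).real (H 0)) * ((prodBernoulli q).real (G 2) - (prodBernoulli q).real (H 2))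
            * (prodBernoulli q).real (H 1)
        + ((prodBernoulli q).real (G 1) - (prodBernoulli q).real (H 1)) * ((prodBernoulli q).real (G 2) - (prodBernoulli q).real (H 2))
            * (prodBernoulli q).real (H 0)
        + ((prodBernoulli q).real (G 0) - (prodBernoulli q).real (H 0)) * ((prodBernoulli q).real (G 1) - (prodBernoulli q).real (H 1))
            * ((prodBernoulli q).real (G 2) - (prodBernoulli q).real (H 2)))
      + (((prodBernoulli q).real (G 0) - (prodBernoulli q).real (H 0))
            * (((prodBernoulli q).real (G 1 ∩ G 2) - (prodBernoulli q).real (G 1) * (prodBernoulli q).real (G 2))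
              - ((prodBernoulli q).real (H 1 ∩ H 2) - (prodBernoulli q).real (H 1) * (prodBernoulli q).real (H 2)))
        + ((prodBernoulli q).real (G 1) - (prodBernoulli q).real (H 1))
            * (((prodBernoulli q).real (G 0 ∩ G 2) - (prodBernoulli q).real (G 0) * (prodBernoulli q).real (G 2))
              - ((prodBernoulli q).real (H 0 ∩ H 2) - (prodBernoulli q).real (H 0) * (prodBernoulli q).real (H 2)))
        + ((prodBernoulli q).real (G 2) - (prodBernoulli q).real (H 2))
            * (((prodBernoulli q).real (G 0 ∩ G 1) - (prodBernoulli q).real (G 0) * (prodBernoulli q).real (G 1))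
              - ((prodBernoulli q).real (H 0 ∩ H 1) - (prodBernoulli q).real (H 0) * (prodBernoulli q).real (H 1))))) :
    0 ≤ topForm q G H := by
  have h := sahiE3_add_sahiE3_le_topForm_of_corrGap_nonneg q G H hCF
  linarith

/-! ### 3. The idle slot: the correlation gap is the bracket of the idle face -/

omit [Fintype κ] in
/-- **With slot `0` idle (`H₀ = G₀`) the correlation gap `M + S` equals the BRACKET of the idle face**
`δ₂·(μ(G₀∩G₁) − μ(G₀∩H₁)) + δ₁·(μ(G₀∩G₂) − μ(G₀∩H₂)) − μ(G₀)·δ₁δ₂` (`SahiTwoLevelVariational.FaceAt`, last disjunct). [this work] -/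
theorem corrGap_eq_bracket_of_idle₀ (q : κ → unitInterval) (G H : Fin 3 → Set (Set κ)) (hidle : H 0 = G 0) :
    (((prodBernoulli q).real (G 0) - (prodBernoulli q).real (H 0)) * ((prodBernoulli q).real (G 1) - (prodBernoulli q).real (H 1))
            * (prodBernoulli q).real (H 2)
        + ((prodBernoulli q).real (G 0) - (prodBernoulli q).real (H 0)) * ((prodBernoulli q).real (G 2) - (prodBernoulli q).real (H 2))
            * (prodBernoulli q).real (H 1)
        + ((prodBernoulli q).real (G 1) - (prodBernoulli q).real (H 1)) * ((prodBernoulli q).real (G 2) - (prodBernoulli q).real (H 2))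
            * (prodBernoulli q).real (H 0)
        + ((prodBernoulli q).real (G 0) - (prodBernoulli q).real (H 0)) * ((prodBernoulli q).real (G 1) - (prodBernoulli q).real (H 1))
            * ((prodBernoulli q).real (G 2) - (prodBernoulli q).real (H 2)))
      + (((prodBernoulli q).real (G 0) - (prodBernoulli q).real (H 0))
            * (((prodBernoulli q).real (G 1 ∩ G 2) - (prodBernoulli q).real (G 1) * (prodBernoulli q).real (G 2))
              - ((prodBernoulli q).real (H 1 ∩ H 2) - (prodBernoulli q).real (H 1) * (prodBernoulli q).real (H 2)))
        + ((prodBernoulli q).real (G 1) - (prodBernoulli q).real (H 1))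
            * (((prodBernoulli q).real (G 0 ∩ G 2) - (prodBernoulli q).real (G 0) * (prodBernoulli q).real (G 2))
              - ((prodBernoulli q).real (H 0 ∩ H 2) - (prodBernoulli q).real (H 0) * (prodBernoulli q).real (H 2)))
        + ((prodBernoulli q).real (G 2) - (prodBernoulli q).real (H 2))
            * (((prodBernoulli q).real (G 0 ∩ G 1) - (prodBernoulli q).real (G 0) * (prodBernoulli q).real (G 1))
              - ((prodBernoulli q).real (H 0 ∩ H 1) - (prodBernoulli q).real (H 0) * (prodBernoulli q).real (H 1)))) =
      ((prodBernoulli q).real (G 2) - (prodBernoulli q).real (H 2))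
          * ((prodBernoulli q).real (G 0 ∩ G 1) - (prodBernoulli q).real (G 0 ∩ H 1))
      + ((prodBernoulli q).real (G 1) - (prodBernoulli q).real (H 1))
          * ((prodBernoulli q).real (G 0 ∩ G 2) - (prodBernoulli q).real (G 0 ∩ H 2))
      - (prodBernoulli q).real (G 0) * ((prodBernoulli q).real (G 1) - (prodBernoulli q).real (H 1))
          * ((prodBernoulli q).real (G 2) - (prodBernoulli q).real (H 2)) := by
  rw [hidle, Set.inter_comm (G 0) (H 1), Set.inter_comm (G 0) (H 2)]
  rw [Set.inter_comm (H 1) (G 0), Set.inter_comm (H 2) (G 0)]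
  ring

/-! ### 4. An unconditional lower bound -/

omit [Fintype κ] in
/-- **Unconditionally `T⁺ ≥ E_3(G) + E_3(H) − (δ₀δ₁h₂ + δ₀δ₂h₁ + δ₁δ₂h₀ + 2δ₀δ₁δ₂)`** for nested pairs `H_i ⊆ G_i`: the only input is
`μ(H_j ∩ H_k) ≤ μ(G_j ∩ G_k)` and `δ_i ≥ 0`. [this work] -/
theorem sahiE3_add_sahiE3_sub_le_topForm (q : κ → unitInterval) (G H : Fin 3 → Set (Set κ)) (hHG : ∀ i, H i ⊆ G i) :
    sahiE3 (prodBernoulli q) (G 0) (G 1) (G 2) + sahiE3 (prodBernoulli q) (H 0) (H 1) (H 2)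
      - (((prodBernoulli q).real (G 0) - (prodBernoulli q).real (H 0)) * ((prodBernoulli q).real (G 1) - (prodBernoulli q).real (H 1))
            * (prodBernoulli q).real (H 2)
        + ((prodBernoulli q).real (G 0) - (prodBernoulli q).real (H 0)) * ((prodBernoulli q).real (G 2) - (prodBernoulli q).real (H 2))
            * (prodBernoulli q).real (H 1)
        + ((prodBernoulli q).real (G 1) - (prodBernoulli q).real (H 1)) * ((prodBernoulli q).real (G 2) - (prodBernoulli q).real (H 2))
            * (prodBernoulli q).real (H 0)
        + 2 * (((prodBernoulli q).real (G 0) - (prodBernoulli q).real (H 0)) * ((prodBernoulli q).real (G 1) - (prodBernoulli q).real (H 1))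
            * ((prodBernoulli q).real (G 2) - (prodBernoulli q).real (H 2))))
      ≤ topForm q G H := by
  rw [topForm_eq_sahiE3_add_sahiE3_add_corrGap]
  have d0 : 0 ≤ (prodBernoulli q).real (G 0) - (prodBernoulli q).real (H 0) := sub_nonneg.2 (measureReal_mono (hHG 0))
  have d1 : 0 ≤ (prodBernoulli q).real (G 1) - (prodBernoulli q).real (H 1) := sub_nonneg.2 (measureReal_mono (hHG 1))
  have d2 : 0 ≤ (prodBernoulli q).real (G 2) - (prodBernoulli q).real (H 2) := sub_nonneg.2 (measureReal_mono (hHG 2))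
  have m12 : (prodBernoulli q).real (H 1 ∩ H 2) ≤ (prodBernoulli q).real (G 1 ∩ G 2) :=
    measureReal_mono (Set.inter_subset_inter (hHG 1) (hHG 2))
  have m02 : (prodBernoulli q).real (H 0 ∩ H 2) ≤ (prodBernoulli q).real (G 0 ∩ G 2) :=
    measureReal_mono (Set.inter_subset_inter (hHG 0) (hHG 2))
  have m01 : (prodBernoulli q).real (H 0 ∩ H 1) ≤ (prodBernoulli q).real (G 0 ∩ G 1) :=
    measureReal_mono (Set.inter_subset_inter (hHG 0) (hHG 1))
  -- `δ_i · (μ(G_j∩G_k) − μ(H_j∩H_k)) ≥ 0`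
  have p0 := mul_nonneg d0 (sub_nonneg.2 m12)
  have p1 := mul_nonneg d1 (sub_nonneg.2 m02)
  have p2 := mul_nonneg d2 (sub_nonneg.2 m01)
  -- the covariance differences, rewritten: `Cov(G_j,G_k) − Cov(H_j,H_k) = [μ(G_jG_k) − μ(H_jH_k)] − (g_jg_k − h_jh_k)`
  set g0 := (prodBernoulli q).real (G 0); set g1 := (prodBernoulli q).real (G 1); set g2 := (prodBernoulli q).real (G 2)
  set h0 := (prodBernoulli q).real (H 0); set h1 := (prodBernoulli q).real (H 1); set h2 := (prodBernoulli q).real (H 2)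
  nlinarith [p0, p1, p2, mul_nonneg d0 d1, mul_nonneg (mul_nonneg d0 d1) d2]

/-! ### 5. Good-coordinate form -/

/-- **A coordinate whose section pair lies in the correlation face is a good coordinate**: for increasing events `A, B, C` and a coordinate
`e`, if `E_3 ≥ 0` for the two section triples and the correlation gap of the section pair is `≥ 0`, then `E_3(A,B,C) ≥ 0`
(`sahiE3_nonneg_of_topForm_secAt_nonneg`). [this work] -/
theorem sahiE3_nonneg_of_corrGapAt_nonneg (q : κ → unitInterval) (e : κ) {A B C : Set (Set κ)}
    (hA : IsUpperSet A) (hB : IsUpperSet B) (hC : IsUpperSet C)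
    (h0 : 0 ≤ sahiE3 (prodBernoulli q) (secAt e false A) (secAt e false B) (secAt e false C))
    (h1 : 0 ≤ sahiE3 (prodBernoulli q) (secAt e true A) (secAt e true B) (secAt e true C))
    (hCF : let G : Fin 3 → Set (Set κ) := ![secAt e true A, secAt e true B, secAt e true C]
      let H : Fin 3 → Set (Set κ) := ![secAt e false A, secAt e false B, secAt e false C]
      0 ≤
      (((prodBernoulli q).real (G 0) - (prodBernoulli q).real (H 0)) * ((prodBernoulli q).real (G 1) - (prodBernoulli q).real (H 1))
            * (prodBernoulli q).real (H 2)
        + ((prodBernoulli q).real (G 0) - (prodBernoulli q).real (H 0)) * ((prodBernoulli q).real (G 2) - (prodBernoulli q).real (H 2))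
            * (prodBernoulli q).real (H 1)
        + ((prodBernoulli q).real (G 1) - (prodBernoulli q).real (H 1)) * ((prodBernoulli q).real (G 2) - (prodBernoulli q).real (H 2))
            * (prodBernoulli q).real (H 0)
        + ((prodBernoulli q).real (G 0) - (prodBernoulli q).real (H 0)) * ((prodBernoulli q).real (G 1) - (prodBernoulli q).real (H 1))
            * ((prodBernoulli q).real (G 2) - (prodBernoulli q).real (H 2)))
      + (((prodBernoulli q).real (G 0) - (prodBernoulli q).real (H 0))
            * (((prodBernoulli q).real (G 1 ∩ G 2) - (prodBernoulli q).real (G 1) * (prodBernoulli q).real (G 2))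
              - ((prodBernoulli q).real (H 1 ∩ H 2) - (prodBernoulli q).real (H 1) * (prodBernoulli q).real (H 2)))
        + ((prodBernoulli q).real (G 1) - (prodBernoulli q).real (H 1))
            * (((prodBernoulli q).real (G 0 ∩ G 2) - (prodBernoulli q).real (G 0) * (prodBernoulli q).real (G 2))
              - ((prodBernoulli q).real (H 0 ∩ H 2) - (prodBernoulli q).real (H 0) * (prodBernoulli q).real (H 2)))
        + ((prodBernoulli q).real (G 2) - (prodBernoulli q).real (H 2))
            * (((prodBernoulli q).real (G 0 ∩ G 1) - (prodBernoulli q).real (G 0) * (prodBernoulli q).real (G 1))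
              - ((prodBernoulli q).real (H 0 ∩ H 1) - (prodBernoulli q).real (H 0) * (prodBernoulli q).real (H 1))))) :
    0 ≤ sahiE3 (prodBernoulli q) A B C := by
  refine sahiE3_nonneg_of_topForm_secAt_nonneg q e hA hB hC ?_ h0 h1
  have hT := topForm_nonneg_of_corrGap_nonneg q ![secAt e true A, secAt e true B, secAt e true C]
    ![secAt e false A, secAt e false B, secAt e false C]
  simp only [Matrix.cons_val_zero, Matrix.cons_val_one, Matrix.head_cons, Matrix.cons_val_two, Matrix.tail_cons] at hT hCF h0 h1 ⊢
  exact hT h1 h0 hCF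

end SahiTwoLevelVariational

end Summit.CriticalPhenomena.PercolationContinuityZ3.Theorems
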